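import Summits.BirchSwinnertonDyer.Rank1Residual.Ordinary.Conjectures.KolyvaginKimDatumOfEulerSystemAnyPrime
import Summits.BirchSwinnertonDyer.Rank1Residual.Ordinary.Conjectures.KolyvaginKimDatumOfEulerSystemLawAtThree
import Summits.BirchSwinnertonDyer.Rank1Residual.Ordinary.Conjectures.KolyvaginKimDatumOfEulerSystemReduction
import Summits.BirchSwinnertonDyer.Rank1Residual.GaloisImage.PropagatedConditionTopOfNoTorsionAnyPrime
import HarnessLib

/-!
# LAW-2 and the Kolyvagin-class datum from an EULER SYSTEM of `T_pE` at ANY ODD good non-anomalous PRIME `p`, with THEOREM D's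
# place-`p` certificate `htop` DISCHARGED (Mazur–Rubin Lemma A.1 at every level, generic prime — GaloisImage F36) — theorems only;
# nothing asserted; C-16 / the depth law stay CONJECTURES (cell `b2b-bsdres`, seat `b2b-bsdres-additive-p3` GEN 42, file F37)

HONEST FRAMING (cell `b2b-bsdres`, run/shared/lean/b2b/bsd-rank1-residual/, verbatim in every
file): the goal of the cell is to DELETE the COMBINATION-SHAPED residual classes of the
Birch–Swinnerton-Dyer formula for ALL analytic-rank `≤ 1` elliptic curves over `ℚ` — "full BSD
formula for every rank `≤ 1` curve in class `C`" assembled STRICTLY from published theorems — so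
that the rank-`≤ 1` remainder becomes exactly the CONSTRUCTION-SHAPED classes, which are TYPED
(missing-input `Prop`s), NOT attempted. This is not "finishing BSD". Seat `b2b-bsdres-additive-p3`
(X8 prover B / X7 joint; typer-designate for the cell conjecture C-16 = hyp C120.1; ladder BSD:K3 hand-off to cell
`bsd-ssimc`; a generation seated inside the D-0075 claim window). This file books nothing and moves no mark; X7 / X8 stay
CONSTRUCTION-SHAPED; C-16 and the depth law (`R1-DEPTH-LAW.md`) are CONJECTURES. NO Euler system is asserted to exist (binder `hc`).

## What this file does

F32 (`KolyvaginKimDatumOfEulerSystemAnyPrime.lean`) composed the C-16 chain with n1011's generic THEOREM D at any odd prime `p`,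
displaying THEOREM D's place-`p` certificate as the binder `htop : 𝓕_can,p(E[p^k·p])_w = ⊤` (`w ∋ p`). At `p = 3` that certificate
was discharged from the letter data by n1011's F11/F12 (Mazur–Rubin Lemma A.1 along the reduction tower; F35). GaloisImage F36
(`PropagatedConditionTopOfNoTorsionAnyPrime.lean`, `propagatedSelmerStructure_eq_top_of_torsion_eq_zero`) is Lemma A.1 at EVERY level
for a GENERIC prime, so the same discharge now works at every odd good non-anomalous `p`:

* §1 **`propagatedSelmerStructure_eq_top_of_not_dvd_reductionPointCount`** — for an odd prime `p` with `p ∤ Δ_min` and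
  `p ∤ #Ẽ(𝔽_p)`: `𝓕_can,p(E[p^k·p])_w = ⊤` at the place `w` over `p`, every `k` (F35 §1 `E(ℚ_w)[p] = 0` in the `adicCompletion`
  currency ∘ F36 along F34's tower `exists_torsionReductionTower W p`).
* §2 **`kolyvaginKimDatum_of_isEulerSystem_torsionCoeff_prime_canonicalTop`** — F32 §1 (the datum `KolyvaginKimDatum W f p ℓ k₀ (k+1) Q vℓ vp ψ`
  from an Euler system of `T_pE`) with `htop` DISCHARGED from the two letter clauses `p ∤ Δ_min`, `p ∤ #Ẽ(𝔽_p)` (added as binders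
  `hgoodp`, `hna`); THEOREM D's ONLY remaining curve-level certificate is `hbad` (`E(ℚ_w)[p] = 0` at the bad `w ≠ p`).
* §3 **`zmodPowOrd_kuriharaNumber_eq_of_isEulerSystem_torsionCoeff_canonicalTop`** — F32 §2, LAW-2 at `(ℓ, k₀)`
  `ord_p(δ̃_ℓ mod p^{k₀}) = min(k₀, F + 2·v_ℓ(P))` (any formal level `m = m_p(P)`, derived regime), with `htop` DISCHARGED from the letter
  data F32 already displays (`hgoodp`, `hna`): remaining displayed inputs = Poitou–Tate ∧ local Euler characteristic (published named
  facts) ∧ letter data ∧ THEOREM D's row certificate `hbad` ∧ «an Euler system of `T_pE` over the cyclotomic levels (binder; Kato,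
  Astérisque 295 Thm. 8.1/12.5 at `p ≥ 5`) + THE CANONICAL Kolyvagin datum `∋ vℓ` + Sakamoto's `(Sτ, τ)` + the divisibility witness +
  the two readings of the derived classes (bottom class MR Thm. 5.2.12; Kim Thm. 3.13 + (5.3), print for `p ≥ 5`)» — exactly the K3
  typer's T1′/T2′/T3′ of `HOME/b2b-bsdres-additive-p3/HANDOFF-TO-bsd-ssimc-K3.md` §2 plus the row condition. No new mathematics here
  (F32 applied to §1); the depth law itself stays a CONJECTURE of the cell.

References: B. Mazur, K. Rubin, Mem. AMS 799 (2004), Def. 3.2.1, Thm. 3.2.4, Thm. 5.2.12, App. A Lemma A.1 [MazurRubin2004];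
K. Kato, Astérisque 295 (2004), Thm. 8.1, Thm. 12.5 [Kato2004Asterisque]; K. Rubin, *Euler Systems* (2000) Def. 2.1.1,
§4.4 [Rubin2000]; R. Sakamoto, JTNB 36 (2024) §2, Def. 4.1 [Sakamoto2024]; C.-H. Kim, arXiv:2203.12159, Thm. 3.13, (5.3)
[Kim2022StructureSelmer]; J. S. Milne, ADT (2006) I 2.8, 4.10(b) [MilneADT2006]; J. H. Silverman, AEC (2009) IV.6.1, VII.2.1
[SilvermanAEC2009].
-/

noncomputable section

open CategoryTheory Function Finset Field IsDedekindDomain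
open scoped NumberField Classical ContRepresentation MatrixGroups
open CongruenceSubgroup WeierstrassCurve Literature.NumberTheory.EllipticCurves
  Literature.NumberTheory.EllipticCurves.ModularForms
  Literature.NumberTheory.EllipticCurves.Rank1Residual
  Literature.NumberTheory.GaloisRepresentations Literature.NumberTheory.GaloisCohomology
  Literature.NumberTheory.GaloisRepresentations.DiscreteGaloisModule
  NumberField
  Summit.BirchSwinnertonDyer.Rank1Residual.GaloisImage
  Summit.BirchSwinnertonDyer.Rank1Residual.GaloisImage.CoeffTransport
  Summit.BirchSwinnertonDyer.Rank1Residual.GaloisImage.CyclotomicLevel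
  Summit.BirchSwinnertonDyer.Rank1Residual.GaloisImage.TorsionCoeff
  Rat.HeightOneSpectrum

namespace Summit.BirchSwinnertonDyer.Rank1Residual.Ordinary

variable (W : WeierstrassCurve ℚ) [W.IsElliptic] [W.IsGloballyMinimal] (p : ℕ) [hp : Fact p.Prime]
variable [Module.Free ℤ_[p] (W.tateModule p)] [Module.Finite ℤ_[p] (W.tateModule p)]
  [ContinuousSMul ℤ_[p] (W.tateModule p)]

/-- Local notation: `T∞ = T_p E` as a continuous `G_ℚ`-representation (as in n1011's THEOREM D files). -/
local notation3 "T∞" => WeierstrassCurve.tateGaloisRep W p (W.continuous_galoisRepTate_holds p)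

variable (S : Set (HeightOneSpectrum (𝓞 ℚ)))

/-- Local notation: `𝓛` = the cyclotomic Euler-system levels `ℚ(μ_{p^{n+1}}, μ_r)`, `r ∩ S = ∅`. -/
local notation3 "𝓛" => cyclotomicLevelsRat p S

/-- Local notation: `𝐃ℤ⟦X, U, τ⟧ ℓ = ∑_{j < ℓ−1} j·(τ_ℓ)_*^j` on `H¹(U, X)` (`ℤ`-linear), Kolyvagin's derivative operator. -/
local notation3 (prettyPrint := false) "𝐃ℤ⟦" X ", " U ", " τ "⟧" =>
  fun ℓ : HeightOneSpectrum (𝓞 ℚ) =>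
  ∑ j ∈ Finset.range (((primesEquiv ℓ : Nat.Primes) : ℕ) - 1),
    (j : Module.End ℤ (continuousCohomology 1 (subgroupRep X U))) *
      (conjMap X U ((τ : HeightOneSpectrum (𝓞 ℚ) → absoluteGaloisGroup ℚ) ℓ) 1).hom.toLinearMap ^ j

/-- Local notation: the level-`j` reduction `red_j : T_pE ⟶ E[p^j]_{ℤ_p}` (n1011 GZ-2). -/
local notation3 "𝐫𝐞𝐝⟦" j "⟧" => tateModuleRed W p (W.continuous_galoisRepTate_holds p) j


/-! ### §1 `𝓕_can,p = ⊤` at every level from `p ∤ Δ_min`, `p ∤ #Ẽ(𝔽_p)` (odd `p`) -/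

section Top

omit [Module.Free ℤ_[p] (W.tateModule p)] [Module.Finite ℤ_[p] (W.tateModule p)]
  [ContinuousSMul ℤ_[p] (W.tateModule p)] in
/-- **`𝓕_can,p(E[p^k·p])_w = ⊤` at the place `w` over an odd prime `p`, every `k`, when `p ∤ Δ_min` and `p ∤ #Ẽ(𝔽_p)`** —
THEOREM D's place-`p` certificate `htop` DISCHARGED from the letter data at a GENERIC prime: F35 §1 gives `E(ℚ_w)[p] = 0`
(AEC IV.6.1 + VII.2.1 in the `adicCompletion` currency), GaloisImage F36 `propagatedSelmerStructure_eq_top_of_torsion_eq_zero`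
(Mazur–Rubin Lemma A.1 along the reduction tower, generic prime) gives `⊤`, the tower being F34's `exists_torsionReductionTower W p`.
[cite: MazurRubin2004, App. A, Lemma A.1 (p. 79)] [cite: SilvermanAEC2009, IV.6.1 and Prop. VII.2.1] -/
theorem propagatedSelmerStructure_eq_top_of_not_dvd_reductionPointCount (hp2 : p ≠ 2)
    (hgoodp : ¬ (p : ℤ) ∣ minimalDiscriminantInt W) (hna : ¬ p ∣ W.reductionPointCount p) (k : ℕ)
    (w : HeightOneSpectrum (𝓞 ℚ)) (hw : ((primesEquiv w : Nat.Primes) : ℕ) = p) :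
    propagatedSelmerStructure W p k (Sum.inr w) = ⊤ := by
  obtain ⟨rd, hrd⟩ := exists_torsionReductionTower W p
  have hv : ((p : ℕ) : 𝓞 ℚ) ∈ w.asIdeal :=
    (natCast_mem_asIdeal_iff_eq_primesEquiv_symm w hp.out).mpr
      (primesEquiv.injective (by rw [Equiv.apply_symm_apply]; exact Subtype.ext hw))
  exact propagatedSelmerStructure_eq_top_of_torsion_eq_zero W p w hv
    (forall_nsmul_eq_zero_adicCompletion_of_not_dvd_reductionPointCount W hp2 hgoodp hna w hv) rd hrd k

end Top

/-! ### §2 The datum from an Euler system of `T_pE`, any odd good non-anomalous `p`, `htop` discharged -/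

section Datum


variable {N : ℕ} (f : CuspForm (Gamma0 N) 2) (ℓ k₀ k : ℕ) [Fact ℓ.Prime] (Q : W.toAffine.Point)
  (vℓ vp : HeightOneSpectrum (𝓞 ℚ)) (ψ : (q : ℕ) → (ZMod q)ˣ →* Multiplicative (ZMod (p ^ k₀)))


/-- **`KolyvaginKimDatum` at depth `k + 1` for ANY ODD good non-anomalous PRIME `p` from an EULER SYSTEM of `T_pE` over the cyclotomic
levels, THEOREM D's place-`p` certificate `htop` DISCHARGED** — F32 §1 `kolyvaginKimDatum_of_isEulerSystem_torsionCoeff_prime` with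
`htop` supplied by §1 from the two letter clauses `p ∤ Δ_min`, `p ∤ #Ẽ(𝔽_p)` (binders `hgoodp`, `hna`). Binders left: the Euler
system `c` (Kato's — NOT asserted), `Irr(E[p])`, THE CANONICAL Kolyvagin datum `D` on `E[p^k·p]` (cyclotomic transverse conditions,
canonical comparison maps, `𝒫 ⊆` level primes ∩ Kato's Kolyvagin primes), THEOREM D's ONLY remaining curve-level certificate `hbad`
(`E(ℚ_w)[p] = 0` at the bad `w ≠ p`), F30's binders (Sakamoto's `(Sτ, τ)`, `vℓ ∈ 𝒫` good with `vℓ ∤ p`, `vp ∋ p`, `hdiv`) and the ONE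
reading hypothesis `hread` (bottom class — Mazur–Rubin Thm. 5.2.12 — and Kim's reading of `κ_{vℓ}` at `vp` — Kim Thm. 3.13 + (5.3),
print for `p ≥ 5`). Nothing asserted. [cite: MazurRubin2004, Thm. 3.2.4, Thm. 5.2.12 and App. A]
[cite: Kim2022StructureSelmer, Thm. 3.13 and (5.3)] [cite: Sakamoto2024, §2 (p. 921) and Def. 4.1 (p. 926)]
[cite: Rubin2000, Def. 2.1.1 and Thm. 4.5.4] [cite: SilvermanAEC2009, IV.6.1 and Prop. VII.2.1] -/
theorem kolyvaginKimDatum_of_isEulerSystem_torsionCoeff_prime_canonicalTop (hp2 : p ≠ 2)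
    (hgoodp : ¬ (p : ℤ) ∣ minimalDiscriminantInt W) (hna : ¬ p ∣ W.reductionPointCount p)
    -- the Euler system and THEOREM D's binders (`htop` is DISCHARGED below)
    {c : ∀ (i : ℕ) (r : (𝓛).Ideals), H1 T∞ ((𝓛).level i r.1)}
    (hc : IsEulerSystem 𝓛 T∞ p c) (hirr : W.HasIrreducibleModPGaloisRep p)
    (D : KolyvaginDatum (W.torsionGaloisModule ((p : ℤ) ^ k * (p : ℤ))))
    (hT : D.transverse = cyclotomicTransverse (W.torsionGaloisModule ((p : ℤ) ^ k * (p : ℤ))))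
    {η : (q : HeightOneSpectrum (𝓞 ℚ)) → (ZMod (Ideal.absNorm q.asIdeal))ˣ}
    (hD : D.HasCanonicalComparison (p ^ (k + 1)) η)
    (hPr : D.primes ⊆ (𝓛).primes)
    (hKol : ∀ q ∈ D.primes, Kato.IsKolyvaginPrime W p (k + 1) ((primesEquiv q : Nat.Primes) : ℕ))
    (hbad : ∀ w : HeightOneSpectrum (𝓞 ℚ), ¬ W.HasGoodReductionAt w →
      ((primesEquiv w : Nat.Primes) : ℕ) ≠ p →
        ∀ P : (W.baseChange (w.adicCompletion ℚ)).toAffine.Point, p • P = 0 → P = 0)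
    -- F30's binders: Sakamoto's `τ`-class for the canonical datum, the place `vℓ`, the divisibility witness
    (Sτ : Set (HeightOneSpectrum (𝓞 ℚ))) {τ : absoluteGaloisGroup ℚ}
    (hτq : Nonempty (cokerSubOne (W.torsionGaloisModule ((p : ℤ) ^ k * (p : ℤ))) τ ≃+ ZMod (p ^ (k + 1))))
    (hτμ : τ ∈ rootsOfUnityFixer ℚ (p ^ (k + 1)))
    (hP : D.primes ⊆ frobeniusClassPrimes (W.torsionGaloisModule ((p : ℤ) ^ k * (p : ℤ))) Sτ τ (p ^ (k + 1)))
    (hDℓ : vℓ ∈ D.primes)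
    (hdiv : ∀ X : geomPoints W, ∃ R : geomPoints W, ((p : ℤ) ^ k * (p : ℤ)) • R = X)
    (hpv : ((p : ℕ) : 𝓞 ℚ) ∉ vℓ.asIdeal) (hgood : W.HasGoodReductionAt vℓ) (hvp : ((p : ℕ) : 𝓞 ℚ) ∈ vp.asIdeal)
    -- the two READINGS of the derived system: bottom class (MR Thm. 5.2.12) and Kim's reading (Thm. 3.13 + (5.3))
    (hread : letI := TorsionCoeff.torsionBy.padicIntModule p (k + 1) (WeierstrassCurve.geomPoints W)
      ∀ (σ : HeightOneSpectrum (𝓞 ℚ) → absoluteGaloisGroup ℚ)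
        (Φ : ∀ r : Finset (HeightOneSpectrum (𝓞 ℚ)),
          continuousCohomology 1 (subgroupRep (torsionRepPadicInt W p (k + 1)).toTopRep ((𝓛).level ⊥ r)) →+
            continuousCohomology 1 (subgroupRep
              (W.torsionGaloisModule ((p : ℤ) ^ k * (p : ℤ))).toTopRep ((𝓛).level ⊥ r)))
        (comm : ∀ r : Finset (HeightOneSpectrum (𝓞 ℚ)),
          ((r : Finset _) : Set (HeightOneSpectrum (𝓞 ℚ))).Pairwise fun a b =>
            Commute (𝐃ℤ⟦(W.torsionGaloisModule ((p : ℤ) ^ k * (p : ℤ))).toTopRep, ((𝓛).level ⊥ r), σ⟧ a)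
              (𝐃ℤ⟦(W.torsionGaloisModule ((p : ℤ) ^ k * (p : ℤ))).toTopRep, ((𝓛).level ⊥ r), σ⟧ b))
        (κ : Finset (HeightOneSpectrum (𝓞 ℚ)) →
          galoisCohomology (W.torsionGaloisModule ((p : ℤ) ^ k * (p : ℤ))) 1),
        (∀ q, σ q ∈ (adicCompletionPrime ℚ q).inertia (absoluteGaloisGroup ℚ)) →
        (∀ q, modNCyclotomicCharacter ℚ (Ideal.absNorm q.asIdeal) (σ q) = η q) →
        (∀ r, ∀ (φ : contOneCocycles (subgroupRep (torsionRepPadicInt W p (k + 1)).toTopRep ((𝓛).level ⊥ r)))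
          (ψ' : contOneCocycles (subgroupRep
            (W.torsionGaloisModule ((p : ℤ) ^ k * (p : ℤ))).toTopRep ((𝓛).level ⊥ r))),
          (∀ g, ψ'.1 g = AddSubgroup.inclusion (geomTorsion_pow_succ_eq W p k).le (φ.1 g)) →
            Φ r (oneCocycleClass _ φ) = oneCocycleClass _ ψ') →
        D.IsKolyvaginSystem (propagatedSelmerStructure W p k) κ →
        (∀ r : Finset (HeightOneSpectrum (𝓞 ℚ)), ¬ (↑r : Set _) ⊆ D.primes → κ r = 0) →
        (∀ (r : Finset (HeightOneSpectrum (𝓞 ℚ))) (hr : (↑r : Set _) ⊆ D.primes),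
          resSubgroup (W.torsionGaloisModule ((p : ℤ) ^ k * (p : ℤ))).toTopRep ((𝓛).level ⊥ r) 1
              (κ r) =
            (r.noncommProd 𝐃ℤ⟦(W.torsionGaloisModule ((p : ℤ) ^ k * (p : ℤ))).toTopRep,
                ((𝓛).level ⊥ r), σ⟧ (comm r))
              (Φ r (ContinuousCohomology.map (ContinuousMonoidHom.id _)
                (X := subgroupRep T∞.toTopRep ((𝓛).level ⊥ r))
                (Y := subgroupRep (torsionRepPadicInt W p (k + 1)).toTopRep ((𝓛).level ⊥ r))
                ((TopRep.resFunctor ((𝓛).level ⊥ r).subtype).map 𝐫𝐞𝐝⟦k + 1⟧) 1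
                (c ⊥ ⟨r, fun _ hq => hPr (hr (Finset.mem_coe.2 hq))⟩)))) →
        κ ∅ = kummerMapTorsion W ((p : ℤ) ^ k * (p : ℤ)) hdiv Q ∧
        ∀ ψp : galoisCohomology ((W.torsionGaloisModule ((p : ℤ) ^ k * (p : ℤ))).toLocal (Sum.inr vp)) 1 ⧸
            W.kummerSelmerStructure ((p : ℤ) ^ k * (p : ℤ)) (Sum.inr vp) ≃+ ZMod (p ^ (k + 1)),
          (haveI : NeZero ℓ := ⟨(Fact.out : ℓ.Prime).ne_zero⟩
           zmodPowOrd p k₀ (kuriharaNumber f (p ^ k₀) ℓ ψ)) =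
            min k₀ (zmodPowOrd p (k + 1)
              (ψp (galoisCohomology.localization (W.torsionGaloisModule ((p : ℤ) ^ k * (p : ℤ)))
                (Sum.inr vp) 1 (κ {vℓ}))))) :
    KolyvaginKimDatum W f p ℓ k₀ (k + 1) Q vℓ vp ψ := by
  have htop : ∀ w : HeightOneSpectrum (𝓞 ℚ), ((primesEquiv w : Nat.Primes) : ℕ) = p →
      propagatedSelmerStructure W p k (Sum.inr w) = ⊤ := fun w hw =>
    propagatedSelmerStructure_eq_top_of_not_dvd_reductionPointCount W p hp2 hgoodp hna k w hw
  exact kolyvaginKimDatum_of_isEulerSystem_torsionCoeff_prime W p S f ℓ k₀ k Q vℓ vp ψ hp2 hc hirr D hT hD hPr hKol hbad htop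
    Sτ hτq hτμ hP hDℓ hdiv hpv hgood hvp hread

end Datum

/-! ### §3 LAW-2 at `(ℓ, k₀)` for any odd good non-anomalous `p` from an Euler system of `T_pE`, `htop` discharged -/

section Law


variable {N : ℕ} (f : CuspForm (Gamma0 N) 2) (ℓ k₀ k : ℕ) [Fact ℓ.Prime] (P : W.toAffine.Point) (F m : ℕ)
  (vℓ vp : HeightOneSpectrum (𝓞 ℚ)) (ψ : (q : ℕ) → (ZMod q)ˣ →* Multiplicative (ZMod (p ^ k₀)))


/-- **LAW-2 at `(ℓ, k₀)` from an EULER SYSTEM of `T_pE`, any odd good non-anomalous `p`, THEOREM D's place-`p` certificate `htop`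
DISCHARGED** — F32 §2 `zmodPowOrd_kuriharaNumber_eq_of_isEulerSystem_torsionCoeff` with `htop` supplied by §1 from the letter data it
already displays (`hgoodp : p ∤ Δ_min`, `hna : p ∤ #Ẽ(𝔽_p)`): `ord_p(δ̃_ℓ mod p^{k₀}) = min(k₀, F + 2·v_ℓ(P))` for any formal level
`m = m_p(P)` in the derived regime, from Poitou–Tate over `ℚ`, the local Euler characteristic at `vℓ` and `vp`, the letter data
(`hm1`/`hm2`, `ℓ` cyclic with `ℓ ∈ 𝒫_{k+1}`, `k₀ ≤ k+1`, `p ∤ u`, `hreg`), an Euler system `c` of `T_pE` over the cyclotomic levels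
(Kato's — a binder, NOT asserted), `Irr(E[p])`, THE CANONICAL datum `D ∋ vℓ`, THEOREM D's ONLY remaining curve-level certificate
`hbad`, Sakamoto's `(Sτ, τ)`, the divisibility witness, and the reading hypothesis on every derived system (bottom class
`κ((p^{m+F}·u)·P)`, MR Thm. 5.2.12; Kim's reading of `κ_{vℓ}` at `vp`, Thm. 3.13 + (5.3)). At `p ≥ 5` every displayed input is
print; the law stays a CONJECTURE of the cell (nothing here asserts its inputs).
[cite: MazurRubin2004, Thm. 3.2.4, Thm. 5.2.12 and App. A] [cite: Kim2022StructureSelmer, Thm. 3.13 and (5.3)]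
[cite: MilneADT2006, Ch. I, Thm. 4.10(b) and Thm. 2.8] [cite: Sakamoto2024, §2 (p. 921) and Def. 4.1 (p. 926)]
[cite: SilvermanAEC2009, IV.6.1 and Prop. VII.2.1] -/
theorem zmodPowOrd_kuriharaNumber_eq_of_isEulerSystem_torsionCoeff_canonicalTop (hp2 : p ≠ 2)
    (hgoodp : ¬ (p : ℤ) ∣ minimalDiscriminantInt W) (hna : ¬ p ∣ W.reductionPointCount p)
    (hm1 : W.reductionPointCount p • Affine.Point.map (W' := W.toAffine) (Algebra.ofId ℚ ℚ_[p]) P ∈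
      (W.baseChange ℚ_[p]).formalFiltration (m + 1))
    (hm2 : W.reductionPointCount p • Affine.Point.map (W' := W.toAffine) (Algebra.ofId ℚ ℚ_[p]) P ∉
      (W.baseChange ℚ_[p]).formalFiltration (m + 2))
    (hcycℓ : IsCyclicKolyvaginLevel W p ℓ)
    (hvℓ : (ℓ : 𝓞 ℚ) ∈ vℓ.asIdeal) (hvp : ((p : ℕ) : 𝓞 ℚ) ∈ vp.asIdeal)
    (hPT : poitouTate_sum_localTatePairing_eq_zero ℚ)
    (hEPℓ : localEulerPoincareCharacteristic (vℓ.adicCompletion ℚ))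
    (hEPp : localEulerPoincareCharacteristic (vp.adicCompletion ℚ))
    (hk : k₀ ≤ k + 1) (hKP : Kato.IsKolyvaginPrime W p (k + 1) ℓ) {u : ℕ} (hu : ¬ p ∣ u)
    (hreg : m = 0 ∨ m + F + 2 * localDivExponent W p ℓ P < k + 1)
    -- the Euler system and THEOREM D's binders (`htop` is DISCHARGED below)
    {c : ∀ (i : ℕ) (r : (𝓛).Ideals), H1 T∞ ((𝓛).level i r.1)}
    (hc : IsEulerSystem 𝓛 T∞ p c) (hirr : W.HasIrreducibleModPGaloisRep p)
    (D : KolyvaginDatum (W.torsionGaloisModule ((p : ℤ) ^ k * (p : ℤ))))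
    (hT : D.transverse = cyclotomicTransverse (W.torsionGaloisModule ((p : ℤ) ^ k * (p : ℤ))))
    {η : (q : HeightOneSpectrum (𝓞 ℚ)) → (ZMod (Ideal.absNorm q.asIdeal))ˣ}
    (hD : D.HasCanonicalComparison (p ^ (k + 1)) η)
    (hPr : D.primes ⊆ (𝓛).primes)
    (hKol : ∀ q ∈ D.primes, Kato.IsKolyvaginPrime W p (k + 1) ((primesEquiv q : Nat.Primes) : ℕ))
    (hbad : ∀ w : HeightOneSpectrum (𝓞 ℚ), ¬ W.HasGoodReductionAt w →
      ((primesEquiv w : Nat.Primes) : ℕ) ≠ p →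
        ∀ P : (W.baseChange (w.adicCompletion ℚ)).toAffine.Point, p • P = 0 → P = 0)
    -- Sakamoto's `τ`-class for the canonical datum, `vℓ ∈ 𝒫`, the divisibility witness
    (Sτ : Set (HeightOneSpectrum (𝓞 ℚ))) {τ : absoluteGaloisGroup ℚ}
    (hτq : Nonempty (cokerSubOne (W.torsionGaloisModule ((p : ℤ) ^ k * (p : ℤ))) τ ≃+ ZMod (p ^ (k + 1))))
    (hτμ : τ ∈ rootsOfUnityFixer ℚ (p ^ (k + 1)))
    (hP : D.primes ⊆ frobeniusClassPrimes (W.torsionGaloisModule ((p : ℤ) ^ k * (p : ℤ))) Sτ τ (p ^ (k + 1)))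
    (hDℓ : vℓ ∈ D.primes)
    (hdiv : ∀ X : geomPoints W, ∃ R : geomPoints W, ((p : ℤ) ^ k * (p : ℤ)) • R = X)
    -- the two READINGS of the derived system, for `Q = (p^{m+F}·u)·P`
    (hread : letI := TorsionCoeff.torsionBy.padicIntModule p (k + 1) (WeierstrassCurve.geomPoints W)
      ∀ (σ : HeightOneSpectrum (𝓞 ℚ) → absoluteGaloisGroup ℚ)
        (Φ : ∀ r : Finset (HeightOneSpectrum (𝓞 ℚ)),
          continuousCohomology 1 (subgroupRep (torsionRepPadicInt W p (k + 1)).toTopRep ((𝓛).level ⊥ r)) →+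
            continuousCohomology 1 (subgroupRep
              (W.torsionGaloisModule ((p : ℤ) ^ k * (p : ℤ))).toTopRep ((𝓛).level ⊥ r)))
        (comm : ∀ r : Finset (HeightOneSpectrum (𝓞 ℚ)),
          ((r : Finset _) : Set (HeightOneSpectrum (𝓞 ℚ))).Pairwise fun a b =>
            Commute (𝐃ℤ⟦(W.torsionGaloisModule ((p : ℤ) ^ k * (p : ℤ))).toTopRep, ((𝓛).level ⊥ r), σ⟧ a)
              (𝐃ℤ⟦(W.torsionGaloisModule ((p : ℤ) ^ k * (p : ℤ))).toTopRep, ((𝓛).level ⊥ r), σ⟧ b))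
        (κ : Finset (HeightOneSpectrum (𝓞 ℚ)) →
          galoisCohomology (W.torsionGaloisModule ((p : ℤ) ^ k * (p : ℤ))) 1),
        (∀ q, σ q ∈ (adicCompletionPrime ℚ q).inertia (absoluteGaloisGroup ℚ)) →
        (∀ q, modNCyclotomicCharacter ℚ (Ideal.absNorm q.asIdeal) (σ q) = η q) →
        (∀ r, ∀ (φ : contOneCocycles (subgroupRep (torsionRepPadicInt W p (k + 1)).toTopRep ((𝓛).level ⊥ r)))
          (ψ' : contOneCocycles (subgroupRep
            (W.torsionGaloisModule ((p : ℤ) ^ k * (p : ℤ))).toTopRep ((𝓛).level ⊥ r))),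
          (∀ g, ψ'.1 g = AddSubgroup.inclusion (geomTorsion_pow_succ_eq W p k).le (φ.1 g)) →
            Φ r (oneCocycleClass _ φ) = oneCocycleClass _ ψ') →
        D.IsKolyvaginSystem (propagatedSelmerStructure W p k) κ →
        (∀ r : Finset (HeightOneSpectrum (𝓞 ℚ)), ¬ (↑r : Set _) ⊆ D.primes → κ r = 0) →
        (∀ (r : Finset (HeightOneSpectrum (𝓞 ℚ))) (hr : (↑r : Set _) ⊆ D.primes),
          resSubgroup (W.torsionGaloisModule ((p : ℤ) ^ k * (p : ℤ))).toTopRep ((𝓛).level ⊥ r) 1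
              (κ r) =
            (r.noncommProd 𝐃ℤ⟦(W.torsionGaloisModule ((p : ℤ) ^ k * (p : ℤ))).toTopRep,
                ((𝓛).level ⊥ r), σ⟧ (comm r))
              (Φ r (ContinuousCohomology.map (ContinuousMonoidHom.id _)
                (X := subgroupRep T∞.toTopRep ((𝓛).level ⊥ r))
                (Y := subgroupRep (torsionRepPadicInt W p (k + 1)).toTopRep ((𝓛).level ⊥ r))
                ((TopRep.resFunctor ((𝓛).level ⊥ r).subtype).map 𝐫𝐞𝐝⟦k + 1⟧) 1
                (c ⊥ ⟨r, fun _ hq => hPr (hr (Finset.mem_coe.2 hq))⟩)))) →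
        κ ∅ = kummerMapTorsion W ((p : ℤ) ^ k * (p : ℤ)) hdiv ((p ^ (m + F) * u) • P) ∧
        ∀ ψp : galoisCohomology ((W.torsionGaloisModule ((p : ℤ) ^ k * (p : ℤ))).toLocal (Sum.inr vp)) 1 ⧸
            W.kummerSelmerStructure ((p : ℤ) ^ k * (p : ℤ)) (Sum.inr vp) ≃+ ZMod (p ^ (k + 1)),
          (haveI : NeZero ℓ := ⟨(Fact.out : ℓ.Prime).ne_zero⟩
           zmodPowOrd p k₀ (kuriharaNumber f (p ^ k₀) ℓ ψ)) =
            min k₀ (zmodPowOrd p (k + 1)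
              (ψp (galoisCohomology.localization (W.torsionGaloisModule ((p : ℤ) ^ k * (p : ℤ)))
                (Sum.inr vp) 1 (κ {vℓ}))))) :
    (haveI : NeZero ℓ := ⟨(Fact.out : ℓ.Prime).ne_zero⟩
     zmodPowOrd p k₀ (kuriharaNumber f (p ^ k₀) ℓ ψ)) = min k₀ (F + 2 * localDivExponent W p ℓ P) := by
  have htop : ∀ w : HeightOneSpectrum (𝓞 ℚ), ((primesEquiv w : Nat.Primes) : ℕ) = p →
      propagatedSelmerStructure W p k (Sum.inr w) = ⊤ := fun w hw =>
    propagatedSelmerStructure_eq_top_of_not_dvd_reductionPointCount W p hp2 hgoodp hna k w hw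
  exact zmodPowOrd_kuriharaNumber_eq_of_isEulerSystem_torsionCoeff W p S f ℓ k₀ k P F m vℓ vp ψ hp2 hgoodp hna hm1 hm2 hcycℓ
    hvℓ hvp hPT hEPℓ hEPp hk hKP hu hreg hc hirr D hT hD hPr hKol hbad htop Sτ hτq hτμ hP hDℓ hdiv hread

end Law

end Summit.BirchSwinnertonDyer.Rank1Residual.Ordinary

end
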